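import Mathlib
import Literature.Probability.Percolation.PercolationProofs
import Literature.Probability.LatticeModels.ProdBernoulliIndependence
import Literature.Probability.Percolation.TwoClusterConditionalAssociation
import Summits.CriticalPhenomena.PercolationContinuityZ3.Theorems.PercNearOneGluingAdditiveGluingKnThm2GoodAux
import Summits.CriticalPhenomena.PercolationContinuityZ3.Theorems.PercNearOneGluingAdditiveGluingKnThm2GoodEvents
import HarnessLib

/-! # Crux `PercNearOneGluing.AdditiveGluing` (stmt-CriticalPhenomena-4576), line
`replica-splice-at-entrance` — stub `stub_knThm2Good`

Helper file for the crux skeleton `Lines/replica_splice_at_entrance.lean` (lead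
prover-line-stmt-CriticalPhenomena-4576-c3-0).  Proves exactly the registered stub signature
`stub_knThm2Good`; lands with `--supports stmt-CriticalPhenomena-4576`.

## Content

Kozma–Nitzan, arXiv:2401.12397, **Theorem 2** (§3.2, pp. 8–9): the pre-FKG gluing inequality
(3) for THREE relays `A = {a₁, a₂, a₃}` in the GOOD case `m₃ ≤ m₁₂`
(`m_T = μ(𝒞(b) ∩ A = T)`), when `a₃` is a worst relay (`τ₃ ≤ τ₁, τ₂`, `τᵢ = μ(aᵢ ↔ b)`), on
the finite weighted graph `Fin n` (`μ = prodBernoulli w`), in the additive E-form the lead needs: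
`μ({o ↔ A} ∖ {o ↔ b}) ≤ t` whenever `μ(a₃ ↔ b) ≥ 1 − t`.

The two tools are taken VERBATIM AS HYPOTHESES (they are the registered neighbour stubs
`stub_bhkSets` — van den Berg–Häggström–Kahn 2006 Thms. 1.3/1.4 for the clusters of vertex
SETS — and `stub_knLemma2` — KN Lemma 2, `φ(1,2) ≥ φ(1) + φ(2)`, denominator-free).

Proof (KN pp. 8–9), with `N₁₂ = {a₁↮a₃} ∩ {a₂↮a₃}`, `N₁ = {a₁↮a₂} ∩ {a₁↮a₃}`,
`N₂ = {a₂↮a₁} ∩ {a₂↮a₃}`, `Pₖ = μ(Nₖ)`, `A₁₂ = μ(N₁₂ ∩ {A₁₂ ↔ o})`, `Aₖ = μ(Nₖ ∩ {aₖ ↔ o})`: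
* `X := μ(o↔A, o↔b) − μ(o↔A, a₃↔b) = I + II + III` (sibling file `…KnThm2GoodEvents`:
  `knThm2_partA/B`, expansions by `𝒞(o) ∩ A` and `𝒞(b) ∩ A`);
* six set-BHK bounds (sibling file `…KnThm2GoodAux`: `knThm2_bhkOne/Two` with
  `S = {a₁,a₂}, X = {a₃}`, `S = {a₁}, X = {a₂,a₃}`, `S = {a₂}, X = {a₁,a₃}`):
  `P₁₂ I ≥ A₁₂ (m₁₂ − m₃)`, `P₁ II ≥ A₁ (m₁ − m₂₃)`, `P₂ III ≥ A₂ (m₂ − m₁₃)`;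
* Lemma 2 (`A₁ P₁₂ P₂ + A₂ P₁₂ P₁ ≤ A₁₂ P₁ P₂`), `m₁₂ ≥ m₃`, `τ₁ − τ₃ = (m₁ + m₁₂) − (m₃ + m₂₃) ≥ 0`,
  `τ₂ − τ₃ ≥ 0` give `P₁ P₂ P₁₂ X ≥ A₁ P₁₂ P₂ (τ₁ − τ₃) + A₂ P₁₂ P₁ (τ₂ − τ₃) ≥ 0`
  (`knThm2_arith`; the cases where some `Pₖ` vanishes use Harris `P₂ P₁₂ ≤ P₁`, `P₁ P₁₂ ≤ P₂`);
* finally `μ(o↔A ∖ o↔b) = μ(o↔A) − μ(o↔A, o↔b) ≤ μ(o↔A) − μ(o↔A, a₃↔b) ≤ μ(a₃ ↮ b) ≤ t`.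
-/

namespace Summit.CriticalPhenomena.PercolationContinuityZ3.Theorems

open MeasureTheory Set Literature.Probability.LatticeModels Literature.Probability.Percolation

noncomputable section
open Classical

variable {n : ℕ}

/-- **KN Theorem 2, core inequality** `μ(o↔A, a₃↔b) ≤ μ(o↔A, o↔b)` (i.e. `I + II + III ≥ 0`)
in the good case `m₃ ≤ m₁₂` with `a₃` worst, from the set-BHK inequalities (hypotheses `hB1`,
`hB2` = the two halves of the registered stub `stub_bhkSets`) and Lemma 2 (hypothesis `hL` =
the conclusion of the registered stub `stub_knLemma2`).
[cite: KozmaNitzan2024, Theorem 2 (§3.2, pp. 8–9)] -/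
theorem knThm2_core
    (hB1 : ∀ (n : ℕ) (w : Sym2 (Fin n) → unitInterval) (S : Finset (Fin n)) (X : Set (Fin n))
        (F G : Set (Sym2 (Fin n)) → ℝ), Monotone F → Monotone G → (∀ s ∈ S, s ∉ X) →
        (∫ ω in {ω : BondConfig (Fin n) | ∀ s ∈ S, ∀ x ∈ X, ¬ (openGraph ω).Reachable s x},
            F (⋃ s ∈ S, openEdgeCluster ω s) ∂(prodBernoulli w)) *
          (∫ ω in {ω : BondConfig (Fin n) | ∀ s ∈ S, ∀ x ∈ X, ¬ (openGraph ω).Reachable s x},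
            G (⋃ s ∈ S, openEdgeCluster ω s) ∂(prodBernoulli w)) ≤
        (prodBernoulli w).real
            {ω : BondConfig (Fin n) | ∀ s ∈ S, ∀ x ∈ X, ¬ (openGraph ω).Reachable s x} *
          ∫ ω in {ω : BondConfig (Fin n) | ∀ s ∈ S, ∀ x ∈ X, ¬ (openGraph ω).Reachable s x},
            F (⋃ s ∈ S, openEdgeCluster ω s) * G (⋃ s ∈ S, openEdgeCluster ω s)
              ∂(prodBernoulli w))
    (hB2 : ∀ (n : ℕ) (w : Sym2 (Fin n) → unitInterval) (S S' : Finset (Fin n))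
        (F G : Set (Sym2 (Fin n)) → ℝ), Monotone F → Monotone G → Disjoint S S' →
        (prodBernoulli w).real
            {ω : BondConfig (Fin n) | ∀ s ∈ S, ∀ x ∈ S', ¬ (openGraph ω).Reachable s x} *
          (∫ ω in {ω : BondConfig (Fin n) | ∀ s ∈ S, ∀ x ∈ S', ¬ (openGraph ω).Reachable s x},
            F (⋃ s ∈ S, openEdgeCluster ω s) * G (⋃ s ∈ S', openEdgeCluster ω s)
              ∂(prodBernoulli w)) ≤
        (∫ ω in {ω : BondConfig (Fin n) | ∀ s ∈ S, ∀ x ∈ S', ¬ (openGraph ω).Reachable s x},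
            F (⋃ s ∈ S, openEdgeCluster ω s) ∂(prodBernoulli w)) *
          (∫ ω in {ω : BondConfig (Fin n) | ∀ s ∈ S, ∀ x ∈ S', ¬ (openGraph ω).Reachable s x},
            G (⋃ s ∈ S', openEdgeCluster ω s) ∂(prodBernoulli w)))
    (hL : ∀ (n : ℕ) (w : Sym2 (Fin n) → unitInterval) (o a₁ a₂ a₃ : Fin n),
        a₁ ≠ a₂ → a₁ ≠ a₃ → a₂ ≠ a₃ →
        (prodBernoulli w).real (openConn o a₁ ∩ ((openConn a₁ a₂)ᶜ ∩ (openConn a₁ a₃)ᶜ)) *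
              (prodBernoulli w).real ((openConn a₁ a₃)ᶜ ∩ (openConn a₂ a₃)ᶜ) *
            (prodBernoulli w).real ((openConn a₂ a₁)ᶜ ∩ (openConn a₂ a₃)ᶜ) +
          (prodBernoulli w).real (openConn o a₂ ∩ ((openConn a₂ a₁)ᶜ ∩ (openConn a₂ a₃)ᶜ)) *
              (prodBernoulli w).real ((openConn a₁ a₃)ᶜ ∩ (openConn a₂ a₃)ᶜ) *
            (prodBernoulli w).real ((openConn a₁ a₂)ᶜ ∩ (openConn a₁ a₃)ᶜ) ≤
        (prodBernoulli w).real
              ((openConn o a₁ ∪ openConn o a₂) ∩ ((openConn a₁ a₃)ᶜ ∩ (openConn a₂ a₃)ᶜ)) *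
            (prodBernoulli w).real ((openConn a₁ a₂)ᶜ ∩ (openConn a₁ a₃)ᶜ) *
          (prodBernoulli w).real ((openConn a₂ a₁)ᶜ ∩ (openConn a₂ a₃)ᶜ))
    (w : Sym2 (Fin n) → unitInterval) (o b a₁ a₂ a₃ : Fin n)
    (h12 : a₁ ≠ a₂) (h13 : a₁ ≠ a₃) (h23 : a₂ ≠ a₃)
    (hτ31 : (prodBernoulli w).real (openConn a₃ b) ≤ (prodBernoulli w).real (openConn a₁ b))
    (hτ32 : (prodBernoulli w).real (openConn a₃ b) ≤ (prodBernoulli w).real (openConn a₂ b))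
    (hgood : (prodBernoulli w).real (openConn b a₃ ∩ (openConn b a₁)ᶜ ∩ (openConn b a₂)ᶜ) ≤
      (prodBernoulli w).real (openConn b a₁ ∩ openConn b a₂ ∩ (openConn b a₃)ᶜ)) :
    (prodBernoulli w).real ((openConn o a₁ ∪ openConn o a₂ ∪ openConn o a₃) ∩ openConn a₃ b) ≤
      (prodBernoulli w).real
        ((openConn o a₁ ∪ openConn o a₂ ∪ openConn o a₃) ∩ openConn o b) := by
  -- the six set-BHK bounds (KN p. 9)
  have i1 := knThm2_bhkOne hB1 w {a₁, a₂} ({a₃} : Set (Fin n)) o b (by simp [h13, h23])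
  have i2 := knThm2_bhkTwo hB2 w {a₁, a₂} {a₃} o b (by simp [h13.symm, h23.symm])
  have i3 := knThm2_bhkOne hB1 w {a₁} ({a₂, a₃} : Set (Fin n)) o b (by simp [h12, h13])
  have i4 := knThm2_bhkTwo hB2 w {a₁} {a₂, a₃} o b (by simp [h12, h13])
  have i5 := knThm2_bhkOne hB1 w {a₂} ({a₁, a₃} : Set (Fin n)) o b (by simp [h12.symm, h23])
  have i6 := knThm2_bhkTwo hB2 w {a₂} {a₁, a₃} o b (by simp [h12.symm, h23])
  rw [knThm2_sep_pair_set, Finset.set_biUnion_insert, Finset.set_biUnion_singleton,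
    Finset.set_biInter_insert, Finset.set_biInter_singleton] at i1
  rw [knThm2_sep_pair_finset, Finset.set_biUnion_insert, Finset.set_biUnion_singleton,
    Finset.set_biInter_singleton] at i2
  rw [knThm2_sep_single_set, Finset.set_biUnion_singleton, Finset.set_biInter_singleton] at i3
  rw [knThm2_sep_single_finset, Finset.set_biUnion_singleton, Finset.set_biInter_insert,
    Finset.set_biInter_singleton] at i4
  rw [knThm2_sep_single_set, Finset.set_biUnion_singleton, Finset.set_biInter_singleton] at i5
  rw [knThm2_sep_single_finset, Finset.set_biUnion_singleton, Finset.set_biInter_insert,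
    Finset.set_biInter_singleton] at i6
  -- Lemma 2 (KN p. 6), with `{o ↔ aₖ} = {aₖ ↔ o}`
  have hL' := hL n w o a₁ a₂ a₃ h12 h13 h23
  rw [knThm2_openConn_comm o a₁, knThm2_openConn_comm o a₂,
    Set.inter_comm (openConn a₁ o) ((openConn a₁ a₂)ᶜ ∩ (openConn a₁ a₃)ᶜ),
    Set.inter_comm (openConn a₂ o) ((openConn a₂ a₁)ᶜ ∩ (openConn a₂ a₃)ᶜ),
    Set.inter_comm (openConn a₁ o ∪ openConn a₂ o) ((openConn a₁ a₃)ᶜ ∩ (openConn a₂ a₃)ᶜ)]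
    at hL'
  -- Harris for the degenerate cases
  have hH2 := knThm2_harris w a₁ a₂ a₃
  have hH1 := knThm2_harris w a₂ a₁ a₃
  rw [Set.inter_comm (openConn a₂ a₃)ᶜ (openConn a₁ a₃)ᶜ] at hH1
  -- `τ₁ − τ₃`, `τ₂ − τ₃` on the atoms, and the good case on the atoms
  have hτ1 := knThm2_tau_sub w b a₁ a₂ a₃
  have hτ2 := knThm2_tau_sub w b a₂ a₁ a₃
  rw [Set.inter_comm (openConn a₂ a₃)ᶜ (openConn a₁ a₃)ᶜ,
    Set.inter_comm (openConn a₂ b) (openConn a₁ b)] at hτ2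
  rw [knThm2_m3, knThm2_m12] at hgood
  -- `X = I + II + III`
  have hA := knThm2_partA w o b a₁ a₂ a₃
  have hB := knThm2_partB w o b a₁ a₂ a₃
  -- trivial bounds
  have hU₁₂ : (prodBernoulli w).real ((openConn a₁ a₃)ᶜ ∩ (openConn a₂ a₃)ᶜ ∩
      ((openConn a₁ o ∪ openConn a₂ o) ∩ openConn a₃ b)) ≤
      (prodBernoulli w).real ((openConn a₁ a₃)ᶜ ∩ (openConn a₂ a₃)ᶜ : Set (BondConfig (Fin n))) :=
    measureReal_mono Set.inter_subset_left
  have hU₁ : (prodBernoulli w).real ((openConn a₁ a₂)ᶜ ∩ (openConn a₁ a₃)ᶜ ∩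
      (openConn a₁ o ∩ (openConn a₂ b ∩ openConn a₃ b))) ≤
      (prodBernoulli w).real ((openConn a₁ a₂)ᶜ ∩ (openConn a₁ a₃)ᶜ : Set (BondConfig (Fin n))) :=
    measureReal_mono Set.inter_subset_left
  have hU₂ : (prodBernoulli w).real ((openConn a₂ a₁)ᶜ ∩ (openConn a₂ a₃)ᶜ ∩
      (openConn a₂ o ∩ (openConn a₁ b ∩ openConn a₃ b))) ≤
      (prodBernoulli w).real ((openConn a₂ a₁)ᶜ ∩ (openConn a₂ a₃)ᶜ : Set (BondConfig (Fin n))) :=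
    measureReal_mono Set.inter_subset_left
  have hm₁₂ : (prodBernoulli w).real ((openConn a₁ a₃)ᶜ ∩ (openConn a₂ a₃)ᶜ ∩
      (openConn a₁ b ∩ openConn a₂ b)) ≤
      (prodBernoulli w).real ((openConn a₁ a₃)ᶜ ∩ (openConn a₂ a₃)ᶜ : Set (BondConfig (Fin n))) :=
    measureReal_mono Set.inter_subset_left
  have key := knThm2_arith measureReal_nonneg measureReal_nonneg measureReal_nonneg hU₁₂ hU₁ hU₂
    measureReal_nonneg measureReal_nonneg measureReal_nonneg measureReal_nonneg measureReal_nonneg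
    measureReal_nonneg measureReal_nonneg hm₁₂ i1 i2 i3 i4 i5 i6 hL' hgood (by linarith)
    (by linarith) hH1 hH2
  linarith

/-- **Kozma–Nitzan arXiv:2401.12397 Theorem 2 (§3.2, pp. 8–9), the GOOD case of three relays,
additive E-form** — exactly the registered stub `stub_knThm2Good` of skeleton v3 of the line
`replica-splice-at-entrance`.  Hypotheses: the set-BHK inequalities (= stub `stub_bhkSets`,
vdBHK 2006 Thms. 1.3/1.4 for clusters of vertex sets) and KN Lemma 2 (= stub `stub_knLemma2`),
both verbatim; three distinct relays `a₁, a₂, a₃ ≠ b` with `μ(aᵢ ↔ b) ≥ 1 − t`, `a₃` worst, and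
the good-case hypothesis `m₃ ≤ m₁₂`.  Conclusion: `μ({o ↔ A} ∖ {o ↔ b}) ≤ t`.  Proof:
`knThm2_core` (`μ(o↔A, a₃↔b) ≤ μ(o↔A, o↔b)`) and
`μ(o↔A ∖ o↔b) = μ(o↔A) − μ(o↔A, o↔b) ≤ μ(o↔A) − μ(o↔A, a₃↔b) ≤ μ(a₃ ↮ b) = 1 − μ(a₃ ↔ b) ≤ t`.
[cite: KozmaNitzan2024, Theorem 2 (§3.2, pp. 8–9)] -/
theorem stub_knThm2Good :
    ((∀ (n : ℕ) (w : Sym2 (Fin n) → unitInterval) (S : Finset (Fin n)) (X : Set (Fin n))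
        (F G : Set (Sym2 (Fin n)) → ℝ), Monotone F → Monotone G → (∀ s ∈ S, s ∉ X) →
        (∫ ω in {ω : BondConfig (Fin n) | ∀ s ∈ S, ∀ x ∈ X, ¬ (openGraph ω).Reachable s x},
            F (⋃ s ∈ S, openEdgeCluster ω s) ∂(prodBernoulli w)) *
          (∫ ω in {ω : BondConfig (Fin n) | ∀ s ∈ S, ∀ x ∈ X, ¬ (openGraph ω).Reachable s x},
            G (⋃ s ∈ S, openEdgeCluster ω s) ∂(prodBernoulli w)) ≤
        (prodBernoulli w).real {ω : BondConfig (Fin n) | ∀ s ∈ S, ∀ x ∈ X, ¬ (openGraph ω).Reachable s x} *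
          ∫ ω in {ω : BondConfig (Fin n) | ∀ s ∈ S, ∀ x ∈ X, ¬ (openGraph ω).Reachable s x},
            F (⋃ s ∈ S, openEdgeCluster ω s) * G (⋃ s ∈ S, openEdgeCluster ω s) ∂(prodBernoulli w)) ∧
    (∀ (n : ℕ) (w : Sym2 (Fin n) → unitInterval) (S S' : Finset (Fin n))
        (F G : Set (Sym2 (Fin n)) → ℝ), Monotone F → Monotone G → Disjoint S S' →
        (prodBernoulli w).real {ω : BondConfig (Fin n) | ∀ s ∈ S, ∀ x ∈ S', ¬ (openGraph ω).Reachable s x} *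
          (∫ ω in {ω : BondConfig (Fin n) | ∀ s ∈ S, ∀ x ∈ S', ¬ (openGraph ω).Reachable s x},
            F (⋃ s ∈ S, openEdgeCluster ω s) * G (⋃ s ∈ S', openEdgeCluster ω s) ∂(prodBernoulli w)) ≤
        (∫ ω in {ω : BondConfig (Fin n) | ∀ s ∈ S, ∀ x ∈ S', ¬ (openGraph ω).Reachable s x},
            F (⋃ s ∈ S, openEdgeCluster ω s) ∂(prodBernoulli w)) *
          (∫ ω in {ω : BondConfig (Fin n) | ∀ s ∈ S, ∀ x ∈ S', ¬ (openGraph ω).Reachable s x},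
            G (⋃ s ∈ S', openEdgeCluster ω s) ∂(prodBernoulli w)))) →
      (∀ (n : ℕ) (w : Sym2 (Fin n) → unitInterval) (o a₁ a₂ a₃ : Fin n), a₁ ≠ a₂ → a₁ ≠ a₃ → a₂ ≠ a₃ →
        (prodBernoulli w).real (openConn o a₁ ∩ ((openConn a₁ a₂)ᶜ ∩ (openConn a₁ a₃)ᶜ)) * (prodBernoulli w).real ((openConn a₁ a₃)ᶜ ∩ (openConn a₂ a₃)ᶜ) * (prodBernoulli w).real ((openConn a₂ a₁)ᶜ ∩ (openConn a₂ a₃)ᶜ) +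
          (prodBernoulli w).real (openConn o a₂ ∩ ((openConn a₂ a₁)ᶜ ∩ (openConn a₂ a₃)ᶜ)) * (prodBernoulli w).real ((openConn a₁ a₃)ᶜ ∩ (openConn a₂ a₃)ᶜ) * (prodBernoulli w).real ((openConn a₁ a₂)ᶜ ∩ (openConn a₁ a₃)ᶜ) ≤
        (prodBernoulli w).real ((openConn o a₁ ∪ openConn o a₂) ∩ ((openConn a₁ a₃)ᶜ ∩ (openConn a₂ a₃)ᶜ)) * (prodBernoulli w).real ((openConn a₁ a₂)ᶜ ∩ (openConn a₁ a₃)ᶜ) * (prodBernoulli w).real ((openConn a₂ a₁)ᶜ ∩ (openConn a₂ a₃)ᶜ)) →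
      ∀ (n : ℕ) (w : Sym2 (Fin n) → unitInterval) (o b a₁ a₂ a₃ : Fin n) (t : ℝ), a₁ ≠ a₂ → a₁ ≠ a₃ → a₂ ≠ a₃ → b ≠ a₁ → b ≠ a₂ → b ≠ a₃ → 0 ≤ t →
        1 - t ≤ (prodBernoulli w).real (openConn a₁ b) → 1 - t ≤ (prodBernoulli w).real (openConn a₂ b) → 1 - t ≤ (prodBernoulli w).real (openConn a₃ b) →
        (prodBernoulli w).real (openConn a₃ b) ≤ (prodBernoulli w).real (openConn a₁ b) → (prodBernoulli w).real (openConn a₃ b) ≤ (prodBernoulli w).real (openConn a₂ b) →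
        (prodBernoulli w).real (openConn b a₃ ∩ (openConn b a₁)ᶜ ∩ (openConn b a₂)ᶜ) ≤ (prodBernoulli w).real (openConn b a₁ ∩ openConn b a₂ ∩ (openConn b a₃)ᶜ) →
        (prodBernoulli w).real ((⋃ a ∈ ({a₁, a₂, a₃} : Finset (Fin n)), openConn o a) \ openConn o b) ≤ t := by
  intro hB hL n w o b a₁ a₂ a₃ t h12 h13 h23 _hb1 _hb2 _hb3 _ht _hτ1 _hτ2 hτ3 hτ31 hτ32 hgood
  have hX := knThm2_core hB.1 hB.2 hL w o b a₁ a₂ a₃ h12 h13 h23 hτ31 hτ32 hgood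
  have hoA : (⋃ a ∈ ({a₁, a₂, a₃} : Finset (Fin n)), (openConn o a : Set (BondConfig (Fin n)))) =
      openConn o a₁ ∪ openConn o a₂ ∪ openConn o a₃ := by
    rw [Finset.set_biUnion_insert, Finset.set_biUnion_insert, Finset.set_biUnion_singleton,
      ← Set.union_assoc]
  rw [hoA]
  have hm : ∀ s : Set (BondConfig (Fin n)), MeasurableSet s := fun _ => MeasurableSet.of_discrete
  have h1 := measureReal_inter_add_sdiff (μ := prodBernoulli w)
    (s := openConn o a₁ ∪ openConn o a₂ ∪ openConn o a₃) (hm (openConn o b))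
  have h2 := measureReal_inter_add_sdiff (μ := prodBernoulli w)
    (s := openConn o a₁ ∪ openConn o a₂ ∪ openConn o a₃) (hm (openConn a₃ b))
  have h3 : (prodBernoulli w).real
      ((openConn o a₁ ∪ openConn o a₂ ∪ openConn o a₃) \ openConn a₃ b) ≤
      (prodBernoulli w).real ((openConn a₃ b)ᶜ : Set (BondConfig (Fin n))) :=
    measureReal_mono fun ω hω => hω.2
  have h4 : (prodBernoulli w).real ((openConn a₃ b)ᶜ : Set (BondConfig (Fin n))) =
      1 - (prodBernoulli w).real (openConn a₃ b : Set (BondConfig (Fin n))) :=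
    probReal_compl_eq_one_sub (hm _)
  linarith

end

end Summit.CriticalPhenomena.PercolationContinuityZ3.Theorems
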